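import Literature.AlgebraicGeometry.Motives.HodgeStructureDivisorClassesNumericalEquivalence
import Literature.AlgebraicGeometry.Motives.HodgeStructureDivisorClassesPicardNumberOne
import HarnessLib

/-!
# Exotic Hodge classes in complementary degrees; no exotic classes for `g ≤ 3`, and for `g ≤ 5` none unless in degree `4`
# (Moonen–Zarhin: "If `dim(X) ≤ 3` then every Hodge class on `X` is a linear combination of products of divisor classes")

[topic AlgebraicGeometry/Motives]

Layer `Literature/AlgebraicGeometry/Motives`, lane `lit-hodgefound` (Track 2 foundations library; prover seat `lit-hodgefound-p34`,
generation 28, row g28-#9). THEOREMS ONLY (no `def`, no named fact, no instance, no notation; net debt `0`). Puts together the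
seat's g28-#7 `Motives/HodgeStructureHodgeClassesHardLefschetz` (`b_p = b_{g-p}`), g28-#8 `Motives/HodgeStructureDivisorClassesNumericalEquivalence`
(`d_p = d_{g-p}`), g28-#4 `Motives/HodgeStructureDivisorClassesPoincareSeriesCriterion` (`D¹ = B¹`, Lefschetz `(1,1)`), g28-#1
(`D⁰ = B⁰ = ⋀⁰`) and g28-#6 (`Dᵖ = Bᵖ = 0` beyond the top degree).

## The sources, verbatim

B. Moonen, Yu. Zarhin, *Hodge classes on abelian varieties of low dimension*, Math. Ann. 315 (1999) 711–733 [MoonenZarhin1999LowDim],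
Introduction: "In this paper we study Hodge classes on complex abelian varieties `X`. If `dim(X) ≤ 3` then every Hodge class on `X` is
a linear combination of products of divisor classes. (This is true for any smooth projective complex variety `X`.) […] The aim of this
note is to extend this to arbitrary abelian varieties of dimension `≤ 5`"; §1: "Hodge classes which do not lie in `D•(X)` are called
exceptional Hodge classes." J. S. Milne, *Lefschetz classes on abelian varieties* (1999) [Milne1999LefschetzClasses], p. 660: "we say
that a Hodge class is *exotic* if it is not Lefschetz"; §5 Prop. 5.2 / Cor. 5.3 (a) (`D_hom = D_num`). P. Deligne, *Hodge cycles on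
abelian varieties* [Deligne1982HodgeCycles], I §2, 2.1 (c) (hard Lefschetz: `x` is a Hodge cycle iff `γ^{d-2p} · x` is).

## Reading on the carrier, and what is PROVED

`H` a `ℚ`-Hodge structure of odd weight `n` on `V`, `dim V = 2g`, `Q` a polarization; `Bᵖ = Hdg^{pn}(⋀^{2p} H) ⊇ Dᵖ = H.divisorClasses p`,
`b_p ≥ d_p` their dimensions; "no exotic (exceptional) classes in degree `2p`" reads `Dᵖ = Bᵖ`.

* `Polarization.finrank_hodgeClasses_sub_finrank_divisorClasses_eq` — **`b_p - d_p = b_q - d_q` for `p + q = g`**: the exotic classes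
  come in complementary degrees; **`Dᵖ = Bᵖ ⟺ D^q = B^q`** (`Polarization.divisorClasses_eq_hodgeClasses_iff_of_add_eq`).
* `Polarization.divisorClasses_eq_hodgeClasses_of_forall_two_mul_le` — **no exotic classes in the degrees `2p ≤ g` ⟹ none at all**;
  `divisorClasses_eq_hodgeClasses_of_lt` (`p > g`: `⋀^{2p} V = 0`).
* `Polarization.divisorClasses_sub_one_eq_hodgeClasses` — **`D^{g-1} = B^{g-1}` always** (`g ≥ 2`; Lefschetz `(1,1)` in the
  complementary degree); `Polarization.finrank_hodgeClasses_sub_one_eq` / `Polarization.finrank_divisorClasses_sub_one_eq`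
  (`b_{g-1} = d_{g-1} = ρ(H)`).
* **`Polarization.divisorClasses_eq_hodgeClasses_of_le_three`** — **`g ≤ 3 ⟹ Dᵖ = Bᵖ` for every `p`**: "If `dim(X) ≤ 3` then every Hodge
  class on `X` is a linear combination of products of divisor classes", here for every polarized odd-weight `ℚ`-Hodge structure of
  rank `≤ 6`.
* **`Polarization.forall_divisorClasses_eq_hodgeClasses_iff_two`** — **`g ≤ 5`: no exotic classes at all ⟺ none in degree `4`**
  (`D² = B²`; the degrees `0, 2` never carry exotic classes and `6, 8, 10` are complementary) — the reduction behind "dimension `≤ 5`".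

## References

* [MoonenZarhin1999LowDim] B. Moonen, Yu. Zarhin, *Hodge classes on abelian varieties of low dimension*, Math. Ann. 315 (1999),
  Introduction (p. 711) and §1.
* [Milne1999LefschetzClasses] J. S. Milne, *Lefschetz classes on abelian varieties*, Duke Math. J. 96 (1999), p. 660, §5 Prop. 5.2,
  Cor. 5.3 (a).
* [Deligne1982HodgeCycles] P. Deligne, *Hodge cycles on abelian varieties*, LNM 900 (1982), I §2, 2.1 (c).
* [Lange2023AbelianVarietiesComplex] H. Lange, *Abelian Varieties over the Complex Numbers* (2023), §7.3.1–§7.3.2.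
-/

noncomputable section

namespace Literature.AlgebraicGeometry.Motives.HodgeStructure

open ExteriorLefschetz ExteriorAlgebra

universe u

variable {V : Type u} [AddCommGroup V] [Module ℚ V] [Module.Finite ℚ V] {n : ℤ} {H : HodgeStructure V n}
  (Q : Polarization H) (hn : Odd n) {g : ℕ} (hg : Module.finrank ℚ V = 2 * g)


include Q hn hg in
/-- **The exotic classes come in complementary degrees: `b_p - d_p = b_q - d_q` for `p + q = g`** (`b_p = b_q` by hard Lefschetz on
Hodge classes, `d_p = d_q` by hard Lefschetz on divisor classes). [cite: Deligne1982HodgeCycles, I §2, 2.1 (c)]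
[cite: Milne1999LefschetzClasses, §5 Prop. 5.2 and p. 660] -/
theorem Polarization.finrank_hodgeClasses_sub_finrank_divisorClasses_eq {p q : ℕ} (hpq : p + q = g) (hle : p ≤ q) :
    Module.finrank ℚ ↥((H.exteriorPower (2 * p)).hodgeClasses (p * n)) - Module.finrank ℚ ↥(H.divisorClasses p) =
      Module.finrank ℚ ↥((H.exteriorPower (2 * q)).hodgeClasses (q * n)) - Module.finrank ℚ ↥(H.divisorClasses q) := by
  obtain rfl : q = g - p := by omega
  rw [Q.finrank_hodgeClasses_two_mul_eq_of_le hn hg (by omega), Q.finrank_divisorClasses_eq_of_le hn hg (by omega)]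

include Q hn hg in
/-- **`Dᵖ = Bᵖ ⟺ D^q = B^q` for `p + q = g`**: no exotic classes in degree `2p` iff none in the complementary degree `2q`.
[cite: Deligne1982HodgeCycles, I §2, 2.1 (c)] [cite: Milne1999LefschetzClasses, §5 Prop. 5.2 and p. 660] -/
theorem Polarization.divisorClasses_eq_hodgeClasses_iff_of_add_eq {p q : ℕ} (hpq : p + q = g) (hle : p ≤ q) :
    H.divisorClasses p = (H.exteriorPower (2 * p)).hodgeClasses (p * n) ↔
      H.divisorClasses q = (H.exteriorPower (2 * q)).hodgeClasses (q * n) := by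
  obtain rfl : q = g - p := by omega
  have hb := Q.finrank_hodgeClasses_two_mul_eq_of_le hn hg (p := p) (by omega)
  have hd := Q.finrank_divisorClasses_eq_of_le hn hg (p := p) (by omega)
  constructor
  · intro h
    refine Submodule.eq_of_le_of_finrank_eq (divisorClasses_le_hodgeClasses H (g - p)) ?_
    rw [← hd, ← hb, h]
  · intro h
    refine Submodule.eq_of_le_of_finrank_eq (divisorClasses_le_hodgeClasses H p) ?_
    rw [hd, hb, h]

include hg in
/-- **Beyond the top degree there is nothing: `Dᵖ = Bᵖ` (`= 0`) for `p > g`** (`⋀^{2p} V = 0`).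
[cite: Lange2023AbelianVarietiesComplex, §7.3.1 Thm. 7.3.1 ("p = 0, …, g")] -/
theorem divisorClasses_eq_hodgeClasses_of_lt (H' : HodgeStructure V n) {p : ℕ} (hp : g < p) :
    H'.divisorClasses p = (H'.exteriorPower (2 * p)).hodgeClasses (p * n) :=
  Submodule.eq_of_le_of_finrank_eq (divisorClasses_le_hodgeClasses H' p)
    (by rw [finrank_divisorClasses_eq_zero_of_finrank_lt H' (by omega), finrank_hodgeClasses_exteriorPower_eq_zero_of_finrank_lt H' (by omega)])

include Q hn hg in
/-- **No exotic classes in the degrees `2p ≤ g` ⟹ no exotic classes at all** (the degrees `2p > g` with `p ≤ g` are complementary to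
degrees `2q < g`; beyond `2g` there is nothing). [cite: Milne1999LefschetzClasses, §5 Prop. 5.2 and p. 660] [cite: Deligne1982HodgeCycles, I §2, 2.1 (c)] -/
theorem Polarization.divisorClasses_eq_hodgeClasses_of_forall_two_mul_le
    (h : ∀ p : ℕ, 2 * p ≤ g → H.divisorClasses p = (H.exteriorPower (2 * p)).hodgeClasses (p * n)) (p : ℕ) :
    H.divisorClasses p = (H.exteriorPower (2 * p)).hodgeClasses (p * n) := by
  by_cases h1 : 2 * p ≤ g
  · exact h p h1
  by_cases h2 : p ≤ g
  · exact (Q.divisorClasses_eq_hodgeClasses_iff_of_add_eq hn hg (p := g - p) (q := p) (by omega) (by omega)).1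
      (h (g - p) (by omega))
  · exact divisorClasses_eq_hodgeClasses_of_lt hg H (by omega)

include Q hn hg in
/-- **`D^{g-1} = B^{g-1}` for `g ≥ 2`**: the Hodge classes of degree `2g - 2` are combinations of products of divisor classes (Lefschetz
`(1,1)` `D¹ = B¹` in the complementary degree). [cite: Milne1999LefschetzClasses, §4 Prop. 4.1 and §5 Prop. 5.2]
[cite: Deligne1982HodgeCycles, I §2, 2.1 (c)] -/
theorem Polarization.divisorClasses_sub_one_eq_hodgeClasses (h2 : 2 ≤ g) :
    H.divisorClasses (g - 1) = (H.exteriorPower (2 * (g - 1))).hodgeClasses ((g - 1 : ℕ) * n) := by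
  refine (Q.divisorClasses_eq_hodgeClasses_iff_of_add_eq hn hg (p := 1) (q := g - 1) (by omega) (by omega)).1 ?_
  rw [divisorClasses_one_eq_hodgeClasses, Nat.cast_one, one_mul]

include Q hn hg in
/-- **`b_{g-1} = ρ(H)`**: the Hodge classes of degree `2g - 2` are as many as the divisor classes of degree `2` (hard Lefschetz
`E^{g-2} ∧ · : B¹ ≅ B^{g-1}`, `g ≥ 2`). [cite: Deligne1982HodgeCycles, I §2, 2.1 (c)] [cite: Milne1999LefschetzClasses, §4 Prop. 4.1] -/
theorem Polarization.finrank_hodgeClasses_sub_one_eq (h2 : 2 ≤ g) :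
    Module.finrank ℚ ↥((H.exteriorPower (2 * (g - 1))).hodgeClasses ((g - 1 : ℕ) * n)) =
      Module.finrank ℚ ↥((H.exteriorPower 2).hodgeClasses n) := by
  rw [← finrank_hodgeClasses_exteriorPower_two_mul_one H, Q.finrank_hodgeClasses_two_mul_eq_of_le hn hg (p := 1) (by omega)]

include Q hn hg in
/-- **`d_{g-1} = ρ(H)`** (`E^{g-2} ∧ · : D¹ ≅ D^{g-1}`, `g ≥ 2`). [cite: Milne1999LefschetzClasses, §5 Prop. 5.2 and §4 Prop. 4.1] -/
theorem Polarization.finrank_divisorClasses_sub_one_eq (h2 : 2 ≤ g) :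
    Module.finrank ℚ ↥(H.divisorClasses (g - 1)) = Module.finrank ℚ ↥((H.exteriorPower 2).hodgeClasses n) := by
  rw [← finrank_divisorClasses_one H, Q.finrank_divisorClasses_eq_of_le hn hg (p := 1) (by omega)]

include Q hn hg in
/-- **`g ≤ 3`: NO EXOTIC CLASSES — `Dᵖ(H) = Bᵖ(H)` for every `p`** ("If `dim(X) ≤ 3` then every Hodge class on `X` is a linear
combination of products of divisor classes"), for every polarized `ℚ`-Hodge structure of odd weight and rank `2g ≤ 6`: the degrees
`2p ≤ g ≤ 3` are `p = 0` (`D⁰ = B⁰ = ⋀⁰`) and `p = 1` (Lefschetz `(1,1)`), the others are complementary or empty.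
[cite: MoonenZarhin1999LowDim, Introduction (p. 711)] [cite: Milne1999LefschetzClasses, §5 Prop. 5.2] -/
theorem Polarization.divisorClasses_eq_hodgeClasses_of_le_three (h3 : g ≤ 3) (p : ℕ) :
    H.divisorClasses p = (H.exteriorPower (2 * p)).hodgeClasses (p * n) := by
  refine Q.divisorClasses_eq_hodgeClasses_of_forall_two_mul_le hn hg (fun p hp ↦ ?_) p
  have hp1 : p ≤ 1 := by omega
  interval_cases p
  · rw [divisorClasses_zero, hodgeClasses_exteriorPower_two_mul_zero_eq_top]
  · rw [divisorClasses_one_eq_hodgeClasses, Nat.cast_one, one_mul]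

include Q hn hg in
/-- **`g ≤ 5`: no exotic classes at all ⟺ none in degree `4` (`D² = B²`)** — the degrees `0` and `2` never carry exotic classes,
the degrees `2p > g` are complementary; this is the reduction to `H⁴` behind "dimension `≤ 5`". [cite: MoonenZarhin1999LowDim, Introduction (p. 711) and §1]
[cite: Milne1999LefschetzClasses, §5 Prop. 5.2 and p. 660] -/
theorem Polarization.forall_divisorClasses_eq_hodgeClasses_iff_two (h5 : g ≤ 5) :
    (∀ p : ℕ, H.divisorClasses p = (H.exteriorPower (2 * p)).hodgeClasses (p * n)) ↔
      H.divisorClasses 2 = (H.exteriorPower (2 * 2)).hodgeClasses ((2 : ℕ) * n) := by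
  refine ⟨fun h ↦ h 2, fun h2 ↦ Q.divisorClasses_eq_hodgeClasses_of_forall_two_mul_le hn hg fun p hp ↦ ?_⟩
  have hp2 : p ≤ 2 := by omega
  interval_cases p
  · rw [divisorClasses_zero, hodgeClasses_exteriorPower_two_mul_zero_eq_top]
  · rw [divisorClasses_one_eq_hodgeClasses, Nat.cast_one, one_mul]
  · exact h2

end Literature.AlgebraicGeometry.Motives.HodgeStructure

end
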